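import Summits.AtomisticToContinuum.Crystallization.Theorems.FrustratedLawDichotomyStrainedPatchHomValueT2TrackClass

/-!
# G5′ TRACK edition, part 4 «K-REDUCIBILITY-48»: the class-amortised near leaf in KERNEL-REDUCIBLE shape (balanced label folds, hint-free box minimum)
# (27623 `(H) HomFloor`, hcp half, E-piece NEAR boxes; decomp-a2c hand-1 g48 — critic row 1668 (5) «K-REDUCIBILITY-48»)

DIAGNOSIS (kernel bisection, `decide +kernel` on the Xmarg own-hE box; NEARGATE5-hand-1-g48 §8): every PRIMITIVE of the kit reduces in the kernel (`Array.ofFn`,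
`Array.set!`, `Array.map`, `List.range/foldl`, `natSqrtUp`, the `FI` arithmetic — 1000 chained `FI.mul/add` in ≈ 1.2 s; `valueP` = 31 TABLE-leaf energy evaluations
in ≈ 1.8 s; `nearB` over 3375 labels in ≈ 33 s; the `passP`/`passJ`/`t2SlopeT2` dispatcher FLAGS; every SINGLE label's 81-entry point Hessian in 1–10 s) — there is
NO well-founded / `partial` / `implemented_by` blocker on the evaluated path.  What does not come back (rc 1 «did not reduce to isTrue/isFalse» after 100–160 s, ALSO
with `maxHeartbeats 0`, `maxRecDepth 10⁵` and the balanced folds of this file) is any quantity that forces the coefficient/Hessian arithmetic of ALL ≈ 586 labels of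
a box: the kernel's cost is ≈ 1 ms per interval operation (×50–100 the interpreter) and ≈ 2–10 s per label once the closed-form coefficient hulls are involved
(×300–1000; `coeffT` alone 2.3 s, `phiFI (thin q)` 1.1 s for label (1,1,0)), i.e. ≳ 30–60 min per box if it completed.  VERDICT «K-REDUCIBILITY-48»: the value/slope
kit is STRUCTURALLY kernel-reducible but ECONOMICALLY N-ONLY (K/I ≈ 10²–10³ on its per-label arithmetic); a K-priced near leaf needs the H-certificate's TABLE
currency (tabulated `(α, β, α′/ρ)` hulls on a `q`-grid + integer table assembly — the table leaf evaluates a full two-family energy in ≈ 60 ms in the kernel), an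
L-sized new instrument; or the operator's precompiled-modules lever; or the licensed `native_decide` fallback.
This file keeps the two kernel-hygiene changes that ARE needed by any K or N shard certificate enumerating boxes without per-box hints:
(i) BALANCED folds — per-label pieces combined by `treeFold` (pairwise halving, nesting depth `⌈log₂ 586⌉ = 10` instead of 586; the left-nested `addArr` chains of
`passP` exceed the default recursion budget); (ii) NO in-kernel anchor search and no shift search: the box minimum is expanded at `t⋆ = 0` (sound for any anchor; costs
0.013 m on Xmarg versus the 40-sweep anchor — a per-class anchor hint is the upgrade) and the PSD shift `κ` is an INPUT re-validated by `psdTestN` (flag false if it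
fails); (iii) everything else is parts 1–3 verbatim.
§20 `pairUp`/`treeFold`; §21 `pointPassT` (balanced point pass), `classPassT` (balanced class pass); §22 ★ `t2NearKk K κ win n μ c w aP` (the K-edition member report,
same output shape as `t2NearK`).
DEFINITIONS ONLY; soundness debts unchanged ((I1) class + `sup_box ≤ sup_K`); 0 sorry; no instances / notation / `#eval`.  `--supports stmt-AtomisticToContinuum-27623`.
-/

namespace Summit.AtomisticToContinuum.Crystallization.Theorems.FrustratedLawDichotomyStrainedPatchHomValueT2Kit

open Literature.Analysis.ValidatedNumerics.Numerics
open Summit.AtomisticToContinuum.Crystallization.Theorems.FrustratedLawDichotomyStrainedPatchHomEntryGram (cen rad)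
open Summit.AtomisticToContinuum.Crystallization.Theorems.FrustratedLawDichotomyStrainedPatchHomEntryGramHcp (shufFI)
open Summit.AtomisticToContinuum.Crystallization.Theorems.FrustratedLawDichotomyStrainedPatchHomCurvCentreKit (boxE cenE cenX)
open Summit.AtomisticToContinuum.Crystallization.Theorems.FrustratedLawDichotomyStrainedPatchHomHertzN (psdTestN)

/-! ## §20. Balanced folds -/

/-- Combine adjacent pairs: `[a, b, c, d, e] ↦ [f a b, f c d, e]`. -/
def pairUp {α : Type} (f : α → α → α) : List α → List α
  | a :: b :: rest => f a b :: pairUp f rest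
  | l => l

/-- ★ **Balanced fold**: repeatedly `pairUp` until one element is left (`fuel` halvings; with `fuel ≥ length` it never truncates — the `0`-fuel branch falls back to
the plain fold, so the result is the full combination for ANY fuel).  Nesting depth of the result term: `O(log length)`. -/
def treeFold {α : Type} (f : α → α → α) (z : α) : ℕ → List α → α
  | 0, l => l.foldl f z
  | _ + 1, [] => z
  | _ + 1, [a] => a
  | fuel + 1, a :: b :: rest => treeFold f z fuel (pairUp f (a :: b :: rest))

/-! ## §21. Balanced point pass and balanced class pass -/

/-- Entrywise sum of two point accumulators. -/
def AccP.add (P Q : AccP) : AccP := ⟨P.ok && Q.ok, addArr 81 P.H Q.H, addArr 9 P.g Q.g, addArr 3 P.fc Q.fc, addArr 18 P.jc Q.jc⟩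

/-- The empty point accumulator. -/
def AccP.zero : AccP := ⟨true, zeroArr 81, zeroArr 9, zeroArr 3, zeroArr 18⟩

/-- Point piece of one `A`-family label. -/
def ptPieceA (EP : Fin 3 × Fin 3 → FI) (b : Fin 3 → ℤ) : AccP :=
  match mkPRec 6 EP (pA b) with
  | none => ⟨false, zeroArr 81, zeroArr 9, zeroArr 3, zeroArr 18⟩
  | some Rp =>
    let gb : Array FI := Array.ofFn fun a : Fin 9 => if 6 ≤ a.val then fi0 else Rp.co.be.mul (Rp.z a.val)
    ⟨true, hessOf Rp true, gb, zeroArr 3, zeroArr 18⟩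

/-- Point piece of one `B`-family label (`lip` = its class on the class box). -/
def ptPieceB (EP : Fin 3 × Fin 3 → FI) (XP : Fin 3 → FI) (aP : Fin 3 → Fin 6 → ℤ) (lip : Bool) (b : Fin 3 → ℤ) : AccP :=
  match mkPRec 9 EP (qB XP b) with
  | none => ⟨false, zeroArr 81, zeroArr 9, zeroArr 3, zeroArr 18⟩
  | some Rp =>
    let gb : Array FI := Array.ofFn fun a : Fin 9 => Rp.co.be.mul (Rp.z a.val)
    let fc : Array FI := Array.ofFn fun a : Fin 3 => Rp.co.be.mul (Rp.y a)
    let jc : Array FI := if lip then Array.ofFn fun n : Fin 18 => jF aP Rp ⟨n.val / 6, by omega⟩ (n.val % 6) else zeroArr 18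
    ⟨true, hessOf Rp false, gb, fc, jc⟩

/-- ★ **Balanced point pass** of a member box over the class label lists. -/
def pointPassT (K : ClassData) (c : (Fin 3 × Fin 3) ⊕ Fin 3 → ℤ) (aP : Fin 3 → Fin 6 → ℤ) : AccP :=
  let EP := cenE c
  let XP := cenX c
  let pieces : List AccP :=
    K.LA.map (ptPieceA EP) ++ K.LBlip.map (ptPieceB EP XP aP true) ++ K.LBhull.map (ptPieceB EP XP aP false)
  treeFold AccP.add AccP.zero pieces.length pieces

/-- Per-label piece of the class pass: guard, `Λ` (729), `R` (81), `S` (243), `J` (18). -/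
structure ClassPiece where
  /-- guard -/
  ok : Bool
  /-- `Λ` contribution -/
  lam : Array ℤ
  /-- `R` contribution -/
  r0 : Array ℤ
  /-- `S` contribution -/
  s2 : Array ℤ
  /-- `J` contribution -/
  jh : Array ℤ

/-- Entrywise integer array sum (first `n` entries). -/
def addArrZ (n : ℕ) (A B : Array ℤ) : Array ℤ := Array.ofFn fun i : Fin n => A.getD i.val 0 + B.getD i.val 0

/-- Sum of two class pieces. -/
def ClassPiece.add (P Q : ClassPiece) : ClassPiece :=
  ⟨P.ok && Q.ok, addArrZ 729 P.lam Q.lam, addArrZ 81 P.r0 Q.r0, addArrZ 243 P.s2 Q.s2, addArrZ 18 P.jh Q.jh⟩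

/-- The empty class piece. -/
def ClassPiece.zero : ClassPiece := ⟨true, Array.replicate 729 0, Array.replicate 81 0, Array.replicate 243 0, Array.replicate 18 0⟩

/-- `Λ` piece of one record (`top` = 6 or 9): sorted triples with multiplicity. -/
def lamPiece (top : ℕ) (Rb : DRec) : Array ℤ :=
  Array.ofFn fun n : Fin 729 =>
    let a := n.val / 81
    let b := n.val / 9 % 9
    let m := n.val % 9
    if a ≤ b ∧ b ≤ m ∧ m < top then mult3 a b m * (thirdOf Rb a b m).absHi else 0

/-- `R` piece of one record: the class-hull WIDTHS of its Hessian entries. -/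
def r0Piece (maskX : Bool) (Rb : DRec) : Array ℤ :=
  let Hb := hessOf Rb maskX
  Array.ofFn fun n : Fin 81 => (Hb.getD n.val fi0).hi - (Hb.getD n.val fi0).lo

/-- `S` piece of one `B` record: `|∂_k∂_l F_a|` on `k ≤ l` with multiplicity. -/
def s2Piece (Rb : DRec) : Array ℤ :=
  Array.ofFn fun n : Fin 243 =>
    let a : Fin 3 := ⟨n.val / 81 % 3, by omega⟩
    let k := n.val / 9 % 9
    let l := n.val % 9
    if k ≤ l then (if k = l then 1 else 2) * (ddF Rb a k l).absHi else 0

/-- `J` piece of one `B` record. -/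
def jhPiece (aP : Fin 3 → Fin 6 → ℤ) (Rb : DRec) : Array ℤ :=
  Array.ofFn fun n : Fin 18 => (jF aP Rb ⟨n.val / 6, by omega⟩ (n.val % 6)).absHi

/-- Class piece of one `A` label on the class box. -/
def classPieceA (EF : Fin 3 × Fin 3 → FI) (b : Fin 3 → ℤ) : ClassPiece :=
  match mkDRec 6 EF (pA b) with
  | none => { ClassPiece.zero with ok := false }
  | some Rb => if Rb.co.lip then { ClassPiece.zero with lam := lamPiece 6 Rb } else { ClassPiece.zero with r0 := r0Piece true Rb }

/-- Class piece of one `B` label on the class box, with its class flag (`none` = dispatcher failure). -/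
def classPieceB (EF : Fin 3 × Fin 3 → FI) (XF : Fin 3 → FI) (aP : Fin 3 → Fin 6 → ℤ) (b : Fin 3 → ℤ) : ClassPiece × Option Bool :=
  match mkDRec 9 EF (qB XF b) with
  | none => ({ ClassPiece.zero with ok := false }, none)
  | some Rb =>
    if Rb.co.lip then ({ ClassPiece.zero with lam := lamPiece 9 Rb, s2 := s2Piece Rb }, some true)
    else ({ ClassPiece.zero with r0 := r0Piece false Rb, jh := jhPiece aP Rb }, some false)

/-- ★ **Balanced class pass** (same `ClassData` as `classPass`). -/
def classPassT (cK wK : (Fin 3 × Fin 3) ⊕ Fin 3 → ℤ) (aP : Fin 3 → Fin 6 → ℤ) : ClassData :=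
  let wK' := trackW aP wK
  let LA := nearAf cK wK'
  let LB := nearBf cK wK'
  let EF := boxE cK wK'
  let XF := shufFI cK wK'
  let piecesA : List ClassPiece := LA.map (classPieceA EF)
  let piecesB : List (ClassPiece × Option Bool) := LB.map (classPieceB EF XF aP)
  let all : List ClassPiece := piecesA ++ piecesB.map Prod.fst
  let tot := treeFold ClassPiece.add ClassPiece.zero all.length all
  let tagged := LB.zip (piecesB.map Prod.snd)
  let LBlip := (tagged.filter fun p => p.2 == some true).map Prod.fst
  let LBhull := (tagged.filter fun p => p.2 == some false).map Prod.fst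
  ⟨tot.ok, cK, wK', LA, LBlip, LBhull, tot.lam, tot.r0, tot.s2, tot.jh⟩

/-! ## §22. The K-edition member report -/

/-- ★★★ **THE K-EDITION MEMBER REPORT** `t2NearKk K κ tHint win n μ c w aP` — `t2NearK` with the balanced point pass, the box minimum expanded at the anchor
`t⋆ = clip(tHint)` (a hint of ANY provenance, e.g. one per class from the native driver; `[]` ↦ `t⋆ = 0`; clipped into the box, so every hint is admissible), and
the PSD shift `κ ≥ 0` supplied and re-validated by `psdTestN 9 (H̃^c + κ·1)` (flag false otherwise). -/
def t2NearKk (K : ClassData) (κ : ℤ) (tHint : List ℤ) (win : ℤ) (n : ℕ) (μ : ℤ) (c w : (Fin 3 × Fin 3) ⊕ Fin 3 → ℤ) (aP : Fin 3 → Fin 6 → ℤ) :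
    (Bool × ℤ × ℤ × ℤ × ℤ × ℤ × ℤ × ℤ) × (ℤ × ℤ × ℤ) :=
  let w' := trackW aP w
  let wf : Array ℤ := Array.ofFn fun p : Fin 9 => foldW w' p
  let wu := wfU wf
  let P := pointPassT K c aP
  let HT := hessTrack aP P.H
  let gT := gradTrack aP P.g
  let Hc : Array ℤ := HT.map cen
  let Hr : Array ℤ := HT.map rad
  let gc : Array ℤ := gT.map cen
  let gr : Array ℤ := gT.map rad
  let pen6 : ℤ := (List.range 9).foldl (fun s a => (List.range 9).foldl (fun s2 b => if b < a then s2 else (List.range 9).foldl (fun s3 m =>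
      if m < b then s3 else s3 + K.lam.getD (81 * a + 9 * b + m) 0 * wf.getD a 0 * wf.getD b 0 / (SC : ℤ) * wf.getD m 0) s2) s) 0
  let pL : ℤ := cdiv pen6 (6 * (SC : ℤ) * (SC : ℤ))
  let p0 : ℤ := cdiv ((List.range 81).foldl (fun s n => s + K.r0.getD n 0 * wf.getD (n / 9) 0 * wf.getD (n % 9) 0) 0) (2 * (SC : ℤ) * (SC : ℤ))
  let f := fun (a : ℕ) => (P.fc.getD a fi0).absHi
  let j := fun (a : ℕ) => cdiv ((List.range 6).foldl (fun s e => s + (P.jc.getD (6 * a + e) fi0).absHi * wf.getD e 0) 0) (SC : ℤ)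
  let h := fun (a : ℕ) => cdiv ((List.range 6).foldl (fun s e => s + K.jh.getD (6 * a + e) 0 * wf.getD e 0) 0) (SC : ℤ)
  let r := fun (a : ℕ) => cdiv ((List.range 81).foldl (fun s n => if n % 9 < n / 9 then s else
      s + K.s2.getD (81 * a + n) 0 * wf.getD (n / 9) 0 / (SC : ℤ) * wf.getD (n % 9) 0) 0) (2 * (SC : ℤ))
  let G := fun (a : ℕ) => f a + j a + h a + r a
  let psd := decide (0 ≤ κ) && psdTestN 9 (shiftedK Hc κ)
  let okAll := memberOK K c w' && foldGuard c w' && K.ok && P.ok && symOK Hc && psd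
  match valuePW win n μ c with
  | some v =>
    let t : Array ℤ := Array.ofFn fun k : Fin 9 => clipW (tHint.getD k.val 0) (wu.getD k.val 0)
    let bm := boxMin Hc gc wu κ t
    let pP : ℤ := cdiv ((List.range 9).foldl (fun s k => s + gr.getD k 0 * wu.getD k 0) 0) (SC : ℤ) +
      cdiv ((List.range 9).foldl (fun s k => (List.range 9).foldl (fun s2 l => s2 + (Hr.getD (9 * k + l) 0) * wu.getD k 0 * wu.getD l 0) s) 0)
        (2 * (SC : ℤ) * (SC : ℤ))
    ((okAll, v - μ, bm, pP, pL, p0, κ, v + bm - pP - pL - p0 - μ), (G 0, G 1, G 2))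
  | none => ((false, 0, 0, 0, 0, 0, 0, 0), (G 0, G 1, G 2))

end Summit.AtomisticToContinuum.Crystallization.Theorems.FrustratedLawDichotomyStrainedPatchHomValueT2Kit
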